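import Literature.NumberTheory.GaloisCohomology.Howard2004.SemilinearRingChange
import HarnessLib

/-!
# Constructors of `IsBaseChangeBy` (coordinates, instance setting, composition, identity) — proofs only

References: [Howard2004HeegnerKolyvagin] B. Howard, *The Heegner point Kolyvagin system*,
Compos. Math. 140 (2004) 1439–1472 (arXiv:1202.6340) — Def. 1.1.3 (the towers `T/IT` and the
category `Quot(T)`; arXiv Def. 2.1.3, p. 5 L93–99), Rem. 1.2.4 (change of coefficient ring
`T ↦ T ⊗_R R/J`; arXiv Rem. 2.2.4, p. 7 L13–27), H.0 (`T` free of rank two; arXiv p. 7).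

`SemilinearRingChange.lean` introduced the instance-free predicate `IsBaseChangeBy ρ φ ρ' f`
(«the additive surjection `f : T ↠ T'` presents `T' = T ⊗_R R'` along the surjection `φ : R ↠ R'`»)
under which Howard's `I_ℓ`, `I_n`, `𝓛_k` change ring as expected and the quotient-level maps
`T/I_nT →+ T'/I_nT'` of a tower morphism exist with no side condition.  This file supplies the ways
such a predicate is OBTAINED, so that no consumer redoes a kernel computation:

* `IsBaseChangeBy.repr_map_eq_mapRange` / `IsBaseChangeBy.of_basis` — COORDINATES: if `b` is an
  `R`-basis of `T`, `b'` an `R'`-basis of `T'` on the same index type and the `φ`-semilinear additive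
  `f` matches them (`f (b i) = b' i`), then `b'.repr (f m) = φ ∘ (b.repr m)` coordinatewise, `f` is
  surjective and `ker f ⊆ (ker φ)T`; with `Γ_K`-equivariance this is `IsBaseChangeBy` (the case
  `E[p^k] ⊗ A ≅ A² ↠ A'² ≅ E[p^k] ⊗ A'` of the `Λ`-adic towers);
* `IsQuotientBy.isBaseChangeBy` — INSTANCE SETTING: in the situation of `FrobIdealRingChangeProofs`
  (`[Algebra R R'] [Module R N] [IsScalarTower R R' N]`, `algebraMap R R'` surjective, `N` presenting
  `T/JT` over `R` with `J ≤ ker (algebraMap R R')`), `π` is a base change along `algebraMap R R'`;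
* `IsBaseChangeBy.comp` — COMPOSITION: base change along `φ` then along `ψ` is base change along
  `ψ.comp φ` (iterated reductions of a reindexed tower);
* `IsBaseChangeBy.refl` — the identity.

No summit statement is proved here; BSD is not proved by any of this.
-/

set_option autoImplicit false

open Function NumberField IsDedekindDomain Field
open scoped NumberField ContRepresentation Classical

namespace Literature.NumberTheory.GaloisCohomology.Howard2004

open Literature.NumberTheory.GaloisRepresentations
open Literature.NumberTheory.GaloisRepresentations.DiscreteGaloisModule

section Galois

variable {K : Type} [Field K] [NumberField K]
  {R : Type} [CommRing R] {R' : Type} [CommRing R']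
  {M : Type} [AddCommGroup M] [TopologicalSpace M] [DiscreteTopology M] [Module R M]
  {M' : Type} [AddCommGroup M'] [TopologicalSpace M'] [DiscreteTopology M'] [Module R' M']
  {ρ : DiscreteGaloisModule K M} {ρ' : DiscreteGaloisModule K M'}
  {φ : R →+* R'} {f : M →+ M'}

namespace IsBaseChangeBy

/-! ## 1. Coordinates -/

omit [TopologicalSpace M] [DiscreteTopology M] [TopologicalSpace M'] [DiscreteTopology M'] in
/-- **Coordinates of `f m` in matched bases**: if `f` is additive, `φ`-semilinear and carries the
`R`-basis `b` of `T` to the `R'`-basis `b'` of `T'`, then `b'.repr (f m) i = φ (b.repr m i)`.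
[cite: Howard2004HeegnerKolyvagin, Rem. 1.2.4 and H.0 (arXiv Rem. 2.2.4, p. 7)] -/
theorem repr_map_eq_mapRange {ι : Type} (b : Module.Basis ι R M) (b' : Module.Basis ι R' M')
    (hf : ∀ (r : R) (m : M), f (r • m) = φ r • f m) (hb : ∀ i, f (b i) = b' i) (m : M) :
    b'.repr (f m) = (b.repr m).mapRange φ (map_zero φ) := by
  have key : f m = Finsupp.linearCombination R' b' ((b.repr m).mapRange φ (map_zero φ)) := by
    conv_lhs => rw [← b.linearCombination_repr m]
    rw [Finsupp.linearCombination_apply, Finsupp.linearCombination_apply, map_finsuppSum,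
      Finsupp.sum_mapRange_index fun i => zero_smul R' (b' i)]
    simp_rw [hf, hb]
  rw [key, b'.repr_linearCombination]

omit [TopologicalSpace M] [DiscreteTopology M] [TopologicalSpace M'] [DiscreteTopology M'] in
/-- In matched bases, `f m = 0` forces all coordinates of `m` into `ker φ`: `ker f ⊆ (ker φ)T`.
[cite: Howard2004HeegnerKolyvagin, Rem. 1.2.4 and H.0 (arXiv Rem. 2.2.4, p. 7)] -/
theorem mem_ker_smul_top_of_basis {ι : Type} (b : Module.Basis ι R M) (b' : Module.Basis ι R' M')
    (hf : ∀ (r : R) (m : M), f (r • m) = φ r • f m) (hb : ∀ i, f (b i) = b' i) {m : M}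
    (hm : f m = 0) : m ∈ (RingHom.ker φ • (⊤ : Submodule R M) : Submodule R M) := by
  have hcoord : ∀ i, b.repr m i ∈ RingHom.ker φ := fun i => by
    have h := congrArg (fun l : ι →₀ R' => l i) (repr_map_eq_mapRange b b' hf hb m)
    simp only [hm, map_zero, Finsupp.zero_apply, Finsupp.mapRange_apply] at h
    rw [RingHom.mem_ker]
    exact h.symm
  rw [← b.span_eq, Submodule.mem_ideal_smul_span_iff_exists_sum]
  refine ⟨b.repr m, hcoord, ?_⟩
  rw [← Finsupp.linearCombination_apply]
  exact b.linearCombination_repr m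

omit [TopologicalSpace M] [DiscreteTopology M] [TopologicalSpace M'] [DiscreteTopology M'] in
/-- In matched bases with `φ` surjective, `f` is surjective.
[cite: Howard2004HeegnerKolyvagin, Rem. 1.2.4 and H.0 (arXiv Rem. 2.2.4, p. 7)] -/
theorem surjective_of_basis {ι : Type} (b : Module.Basis ι R M) (b' : Module.Basis ι R' M')
    (hφ : Function.Surjective φ) (hf : ∀ (r : R) (m : M), f (r • m) = φ r • f m)
    (hb : ∀ i, f (b i) = b' i) : Function.Surjective f := by
  intro m'
  refine ⟨∑ i ∈ (b'.repr m').support, Function.surjInv hφ (b'.repr m' i) • b i, ?_⟩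
  rw [map_sum]
  simp_rw [hf, Function.surjInv_eq hφ, hb]
  conv_rhs => rw [← b'.linearCombination_repr m', Finsupp.linearCombination_apply]
  rfl

omit [NumberField K] in
/-- **`IsBaseChangeBy` from coordinates**: an additive, `φ`-semilinear (`φ` surjective),
`Γ_K`-equivariant `f : T → T'` carrying an `R`-basis of `T` to an `R'`-basis of `T'` presents the base
change `T' = T ⊗_R R'` — the levels `E[p^k] ⊗ A ≅ A²` of the `Λ`-adic towers along `A ↠ A'`.
[cite: Howard2004HeegnerKolyvagin, Rem. 1.2.4 and H.0 (arXiv Rem. 2.2.4, p. 7)] -/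
theorem of_basis {ι : Type} (b : Module.Basis ι R M) (b' : Module.Basis ι R' M') (hφ : Function.Surjective φ)
    (hf : ∀ (r : R) (m : M), f (r • m) = φ r • f m) (hb : ∀ i, f (b i) = b' i)
    (hρ : ∀ (σ : absoluteGaloisGroup K) (m : M), f (ρ σ m) = ρ' σ (f m)) :
    IsBaseChangeBy ρ φ ρ' f where
  ringHom_surjective := hφ
  surjective := surjective_of_basis b b' hφ hf hb
  map_smul := hf
  ker_le _ hm := mem_ker_smul_top_of_basis b b' hf hb hm
  equivariant := hρ

/-! ## 2. Identity and composition -/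

omit [NumberField K] in
/-- The identity is a base change along `RingHom.id R`.
[cite: Howard2004HeegnerKolyvagin, Def. 1.1.3 (arXiv Def. 2.1.3, p. 5, L93–99)] -/
theorem refl (ρ : DiscreteGaloisModule K M) :
    IsBaseChangeBy ρ (RingHom.id R) ρ (AddMonoidHom.id M) where
  ringHom_surjective := Function.surjective_id
  surjective := Function.surjective_id
  map_smul _ _ := rfl
  ker_le m hm := by
    rw [AddMonoidHom.id_apply] at hm
    rw [hm]
    exact Submodule.zero_mem _
  equivariant _ _ := rfl

omit [NumberField K] in
/-- **Composition**: a base change along `φ : R ↠ R'` followed by one along `ψ : R' ↠ R''` is a base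
change along `ψ.comp φ` (`T ⊗_R R' ⊗_{R'} R'' = T ⊗_R R''`) — e.g. the iterated reductions of a
(reindexed) tower. [cite: Howard2004HeegnerKolyvagin, Def. 1.1.3 and Rem. 1.2.4 (arXiv p. 5 L93–99, p. 7 L13–27)] -/
theorem comp {R'' : Type} [CommRing R''] {M'' : Type} [AddCommGroup M''] [TopologicalSpace M'']
    [DiscreteTopology M''] [Module R'' M''] {ρ'' : DiscreteGaloisModule K M''} {ψ : R' →+* R''}
    {g : M' →+ M''} (hg : IsBaseChangeBy ρ' ψ ρ'' g) (hf : IsBaseChangeBy ρ φ ρ' f) :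
    IsBaseChangeBy ρ (ψ.comp φ) ρ'' (g.comp f) where
  ringHom_surjective := hg.ringHom_surjective.comp hf.ringHom_surjective
  surjective := hg.surjective.comp hf.surjective
  map_smul r m := by
    rw [AddMonoidHom.comp_apply, AddMonoidHom.comp_apply, hf.map_smul, hg.map_smul, RingHom.comp_apply]
  ker_le m hm := by
    rw [AddMonoidHom.comp_apply] at hm
    -- `f m ∈ (ker ψ)•T'`, and `(ker ψ)•T' = f ((ker (ψ ∘ φ))•T)` since `φ` and `f` are surjective.
    have h1 : f m ∈ (RingHom.ker ψ • (⊤ : Submodule R' M') : Submodule R' M') := hg.ker_le _ hm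
    -- pull back along `f`: every element of `(ker ψ)•T'` is `f` of an element of `(ker (ψ∘φ))•T`.
    have h2 : ∀ x ∈ (RingHom.ker ψ • (⊤ : Submodule R' M') : Submodule R' M'),
        ∃ y ∈ (RingHom.ker (ψ.comp φ) • (⊤ : Submodule R M) : Submodule R M), f y = x := by
      intro x hx
      refine Submodule.smul_induction_on hx (fun r' hr' n' _ => ?_) (fun x y hx hy => ?_)
      · obtain ⟨r, rfl⟩ := hf.ringHom_surjective r'
        obtain ⟨n, rfl⟩ := hf.surjective n'
        refine ⟨r • n, Submodule.smul_mem_smul ?_ Submodule.mem_top, hf.map_smul r n⟩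
        rw [RingHom.mem_ker, RingHom.comp_apply]
        exact RingHom.mem_ker.mp hr'
      · obtain ⟨x₁, hx₁, rfl⟩ := hx
        obtain ⟨y₁, hy₁, rfl⟩ := hy
        exact ⟨x₁ + y₁, Submodule.add_mem _ hx₁ hy₁, map_add f x₁ y₁⟩
    obtain ⟨y, hy, hfy⟩ := h2 (f m) h1
    -- `m - y ∈ ker f = (ker φ)•T ⊆ (ker (ψ∘φ))•T`
    have h3 : m - y ∈ (RingHom.ker φ • (⊤ : Submodule R M) : Submodule R M) :=
      hf.ker_le _ (by rw [map_sub, hfy, sub_self])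
    have h4 : (RingHom.ker φ • (⊤ : Submodule R M) : Submodule R M) ≤
        RingHom.ker (ψ.comp φ) • (⊤ : Submodule R M) :=
      Submodule.smul_mono_left fun r hr => by
        rw [RingHom.mem_ker, RingHom.comp_apply, RingHom.mem_ker.mp hr, map_zero]
    have h5 := Submodule.add_mem _ (h4 h3) hy
    rwa [sub_add_cancel] at h5
  equivariant σ m := by rw [AddMonoidHom.comp_apply, AddMonoidHom.comp_apply, hf.equivariant,
    hg.equivariant]

end IsBaseChangeBy

/-! ## 3. From the instance setting of `FrobIdealRingChangeProofs` -/

namespace IsQuotientBy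

omit [NumberField K] in
/-- **Instance setting ⇒ `IsBaseChangeBy`**: if `R'` is an `R`-algebra with surjective structure map,
`T'` an `R'`-module with compatible `R`-structure, and `π : T →ₗ[R] T'` presents `T/JT` with
`J ≤ ker (R → R')` (the situation of `FrobIdealRingChangeProofs`), then `π` presents the base change
along `algebraMap R R'`. [cite: Howard2004HeegnerKolyvagin, Def. 1.1.3 and Rem. 1.2.4 (arXiv p. 5 L93–99, p. 7 L13–27)] -/
theorem isBaseChangeBy [Algebra R R'] [Module R M'] [IsScalarTower R R' M'] {J : Ideal R}
    {π : M →ₗ[R] M'} (h : IsQuotientBy ρ J ρ' π) (hJ : J ≤ RingHom.ker (algebraMap R R'))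
    (hφ : Function.Surjective (algebraMap R R')) :
    IsBaseChangeBy ρ (algebraMap R R') ρ' π.toAddMonoidHom where
  ringHom_surjective := hφ
  surjective := h.surjective
  map_smul r m := by rw [LinearMap.toAddMonoidHom_coe, map_smul, algebraMap_smul]
  ker_le m hm := by
    rw [LinearMap.toAddMonoidHom_coe, ← LinearMap.mem_ker, h.ker_eq] at hm
    exact Submodule.smul_mono_left hJ hm
  equivariant := h.equivariant

end IsQuotientBy

end Galois

end Literature.NumberTheory.GaloisCohomology.Howard2004
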